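import Mathlib
import HarnessLib
import Literature.Computability.AlgebraicComplexity.AsymptoticRankMatMul
import Literature.Barriers.MatrixMultiplication.IrreversibilityBarrierProofs
import Summits.MatrixMultiplication.MatrixMultiplication.Theorems.OutsiderSandwichBlockSubrank

/-!
# OutsiderSandwich — exact asymptotic subranks of the coupled blocks, and the one-tensor rank criterion (decomp-mm lens-4, g17)

* `asymptoticSubrank_le_card : Q̃(t) ≤ |ι|`; hence the EXACT values
  `asymptoticSubrank_coupling₁/₂/₃ : Q̃(C_k) = 4` and `asymptoticSubrank_couplingTensor : Q̃(C) = 64`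
  (lower bounds: `OutsiderSandwichBlockSubrank`, `OutsiderSandwichCouplingSubrankFull`).
* `four_le_asymptoticRank_coupling₁ : 4 ≤ R̃(C₁)`.
* Under the ω-free hypothesis `BlockBelowMM` (`C₁ ≲ ⟨2,2,2⟩`, kernel `OutsiderSandwichBlock`):
  `asymptoticRank_coupling₁_le_of_blockBelowMM : R̃(C₁) ≤ 2^ω` and the ONE-TENSOR RANK CRITERION
  `summit_iff_asymptoticRank_le_four : ω = 2 ⟺ R̃(C₁) ≤ 4`,
  `summit_iff_asymptoticRank_eq_four : ω = 2 ⟺ R̃(C₁) = 4` — the door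
  `OutsiderSandwichCouplingBenchmark.summit_of_asymptoticRank_coupling₁_le_four` becomes an
  equivalence: ω = 2 iff the `4 × 4 × 4` tensor `C₁ = T^{[211]}(cw₂^{⊗2})` satisfies Strassen's
  asymptotic rank conjecture.
-/

noncomputable section

namespace Summit.MatrixMultiplication.MatrixMultiplication.Theorems.OutsiderSandwichBlockRank

open Literature.Computability.AlgebraicComplexity
open Summit.MatrixMultiplication.MatrixMultiplication.Theorems.OutsiderSandwichCoupling
open Literature.Barriers.MatrixMultiplication (subrank_kroneckerPow_le_card_pow)

/-! ## 1. `Q̃(t) ≤ |ι|` and the exact values -/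

/-- **`Q̃(t) ≤ |ι|`** (`Q(t^{⊗N}) ≤ |ι|^N`). -/
theorem asymptoticSubrank_le_card {ι κ μ : Type} [Fintype ι] [Fintype κ] [Fintype μ]
    (t : ι → κ → μ → ℂ) : asymptoticSubrank ℂ t ≤ Fintype.card ι := by
  classical
  unfold asymptoticSubrank
  refine ciSup_le fun m => ?_
  have hq : ((subrank ℂ (kroneckerPow t (m + 1)) : ℝ)) ≤ (Fintype.card ι : ℝ) ^ (m + 1) := by
    exact_mod_cast subrank_kroneckerPow_le_card_pow t (m + 1)
  have hm : (0 : ℝ) ≤ ((m : ℝ) + 1)⁻¹ := by positivity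
  calc ((subrank ℂ (kroneckerPow t (m + 1)) : ℝ)) ^ (((m : ℝ) + 1)⁻¹)
      ≤ ((Fintype.card ι : ℝ) ^ (m + 1)) ^ (((m : ℝ) + 1)⁻¹) :=
        Real.rpow_le_rpow (Nat.cast_nonneg _) hq hm
    _ = Fintype.card ι := by
        rw [← Nat.cast_succ, Real.pow_rpow_inv_natCast (Nat.cast_nonneg _) (Nat.succ_ne_zero m)]

/-- **`Q̃(C₁) = 4`.** -/
theorem asymptoticSubrank_coupling₁ : asymptoticSubrank ℂ coupling₁ = 4 :=
  le_antisymm (by simpa using asymptoticSubrank_le_card coupling₁)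
    OutsiderSandwichBlockSubrank.four_le_asymptoticSubrank_coupling₁

/-- **`Q̃(C₂) = 4`.** -/
theorem asymptoticSubrank_coupling₂ : asymptoticSubrank ℂ coupling₂ = 4 :=
  le_antisymm (by simpa using asymptoticSubrank_le_card coupling₂)
    OutsiderSandwichBlockSubrank.four_le_asymptoticSubrank_couplings.2.1

/-- **`Q̃(C₃) = 4`.** -/
theorem asymptoticSubrank_coupling₃ : asymptoticSubrank ℂ coupling₃ = 4 :=
  le_antisymm (by simpa using asymptoticSubrank_le_card coupling₃)
    OutsiderSandwichBlockSubrank.four_le_asymptoticSubrank_couplings.2.2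

/-- **`Q̃(C) = 64`** for the coupling tensor `C = C₁ ⊠ C₂ ⊠ C₃`. -/
theorem asymptoticSubrank_couplingTensor : asymptoticSubrank ℂ couplingTensor = 64 := by
  refine le_antisymm ?_ OutsiderSandwichCouplingSubrankFull.le_asymptoticSubrank_couplingTensor
  have h := asymptoticSubrank_le_card couplingTensor
  simp only [Fintype.card_prod, Fintype.card_fin] at h
  norm_num at h
  exact h

/-! ## 2. The asymptotic rank of `C₁` -/

/-- **`4 ≤ R̃(C₁)`** (`Q̃ ≤ R̃`). -/
theorem four_le_asymptoticRank_coupling₁ : (4 : ℝ) ≤ asymptoticRank coupling₁ := by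
  obtain ⟨F, hF, hFt⟩ := (strassen_duality_asymptoticSubrank_holds ℂ coupling₁).2
  calc (4 : ℝ) ≤ asymptoticSubrank ℂ coupling₁ :=
        OutsiderSandwichBlockSubrank.four_le_asymptoticSubrank_coupling₁
    _ = F coupling₁ := hFt.symm
    _ ≤ asymptoticRank coupling₁ := (strassen_duality_asymptoticRank_holds ℂ coupling₁).1 F hF

/-- **`C₁ ≲ ⟨2,2,2⟩ ⟹ R̃(C₁) ≤ 2^ω`** (ω-free). -/
theorem asymptoticRank_coupling₁_le_of_blockBelowMM (h : OutsiderSandwichBlock.BlockBelowMM) :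
    asymptoticRank coupling₁ ≤ (2 : ℝ) ^ omega ℂ := by
  obtain ⟨G, hG, hGt⟩ := (strassen_duality_asymptoticRank_holds ℂ coupling₁).2
  rw [← hGt]
  calc G coupling₁ ≤ G (matMulTensor ℂ 2 2 2) := h G hG
    _ ≤ asymptoticRank (matMulTensor ℂ 2 2 2) :=
        (strassen_duality_asymptoticRank_holds ℂ (matMulTensor ℂ 2 2 2)).1 G hG
    _ = (2 : ℝ) ^ omega ℂ := by
        rw [asymptoticRank_matMulTensor ℂ 2 (by norm_num)]
        norm_num

/-- **One-tensor rank criterion** (given `C₁ ≲ ⟨2,2,2⟩`): `ω = 2 ⟺ R̃(C₁) ≤ 4`.  `⟸` is the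
unconditional door `summit_of_asymptoticRank_coupling₁_le_four`; `⟹`: `R̃(C₁) ≤ 2^ω = 4`. -/
theorem summit_iff_asymptoticRank_le_four (h : OutsiderSandwichBlock.BlockBelowMM) :
    _root_.MatrixMultiplication ↔ asymptoticRank coupling₁ ≤ 4 := by
  refine ⟨fun hS => ?_, OutsiderSandwichCouplingBenchmark.summit_of_asymptoticRank_coupling₁_le_four⟩
  have hω : omega ℂ = 2 := (_root_.MatrixMultiplication_iff).1 hS
  have hR := asymptoticRank_coupling₁_le_of_blockBelowMM h
  rw [hω] at hR
  norm_num at hR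
  exact hR

/-- Equivalently `ω = 2 ⟺ R̃(C₁) = 4` (given `C₁ ≲ ⟨2,2,2⟩`). -/
theorem summit_iff_asymptoticRank_eq_four (h : OutsiderSandwichBlock.BlockBelowMM) :
    _root_.MatrixMultiplication ↔ asymptoticRank coupling₁ = 4 :=
  ⟨fun hS => le_antisymm ((summit_iff_asymptoticRank_le_four h).1 hS)
      four_le_asymptoticRank_coupling₁,
    fun hR => (summit_iff_asymptoticRank_le_four h).2 hR.le⟩

/-- Without any hypothesis: `ω > 2 ⟹ 4 < R̃(C₁)` (the unconditional half, recorded for contrast;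
tree `four_lt_asymptoticRank_coupling₁_of_not_summit`) and `C₁ ≲ ⟨2,2,2⟩ ⟹ ω = 2 ∨ 4 < R̃(C₁) ≤ 2^ω`. -/
theorem asymptoticRank_coupling₁_dichotomy (h : OutsiderSandwichBlock.BlockBelowMM) :
    (_root_.MatrixMultiplication ∧ asymptoticRank coupling₁ = 4) ∨
      (¬ _root_.MatrixMultiplication ∧ 4 < asymptoticRank coupling₁ ∧
        asymptoticRank coupling₁ ≤ (2 : ℝ) ^ omega ℂ) := by
  by_cases hS : _root_.MatrixMultiplication
  · exact Or.inl ⟨hS, (summit_iff_asymptoticRank_eq_four h).1 hS⟩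
  · refine Or.inr ⟨hS, ?_, asymptoticRank_coupling₁_le_of_blockBelowMM h⟩
    exact OutsiderSandwichCouplingBenchmark.four_lt_asymptoticRank_coupling₁_of_not_summit hS

end Summit.MatrixMultiplication.MatrixMultiplication.Theorems.OutsiderSandwichBlockRank
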